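import Literature.NumberTheory.LFunctions.FordLemma36Recursion
import HarnessLib

/-!
# Ford's Lemma 3.6, second half: the closed form for the constants `C_n` (`k ≥ 1000`)

Topic `Literature/NumberTheory/LFunctions`. Everything here is PROVED (no named facts). Companion of
`FordLemma36Recursion.lean` (the exponents `Δ_n`).

K. Ford, Proc. LMS 85 (2002), Lemma 3.6: with `ω = 0.06` (`η = 1.06`, `V = 300k³ log k`) the constants
of Lemma 3.5, `C₁ = k!`, `C_n = C_{n−1} max[k^{3k}η^{4k(n−1)+k²}, V^{(k+1)(Δ_{n−1}−Δ_n)}]`, satisfy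
`C_n ≤ k^{2.055k³−5.91k²+3nk} 1.06^{nk²+2k(n²−n)−9.7278k³}`. The proof ((3.20)–(3.21)): `V^{k+1} ≤ W`
(Ford: `W = k^{4.11k}`); for `n ≤ 1.97k + 1` the decrement `Δ_{n−1} − Δ_n ≥ 0.01916k` makes
`W^{Δ_{n−1}−Δ_n}` dominate `k^{3k}η^{4k(n−1)+k²}` (3.20), so `C_{n₀} ≤ k! W^{Δ₁−Δ_{n₀}}`; beyond `n₀`
the two entries of the `max` are multiplied up. As in `FordLemma36Recursion.lean` the statement is in
definition-free form — for an arbitrary sequence `δ_n = Δ_n/k²` satisfying Ford's one-step inequalities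
(3.14) (from above) and `δ_{n+1} ≥ δ_n(1 − 2/k)` (from below, "by the top line of (3.16) and (3.17)")
— and for an arbitrary positive `C_n` obeying the recursion:

* `FordL36.succ_mul_log_V_le` — `(k+1) log(300k³ log k) ≤ 4.12 k log k`, i.e. `V^{k+1} ≤ k^{4.12k}`
  (Ford's `4.11` is true but leaves a margin of `10⁻⁴` at `k = 1000`; `4.12` costs `0.005k³` in the
  final exponent: `2.06` for Ford's `2.055`);
* `FordL36.delta_ge_bar` — `δ_m ≥ 0.0096` for `m ≤ 1.97k + 1`; `FordL36.decrement_ge` — (3.21):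
  `δ_{n−1} − δ_n ≥ 0.019/k`; `FordL36.log_Hn_le` — (3.20);
* `FordL36.log_C_step`, `FordL36.log_C_phase1`, `FordL36.log_C_phase2` — the recursion in logarithms;
* `FordL36.C_le_closed_form` — **`C_n ≤ k^{2.06k³ − 5.91k² + 3nk} · 1.06^{nk² + 2(n²−n)k − 9.7278k³}`
  for `n ≥ 2k`.**

Numerical inputs: `log 1000 ∈ [6.9, 6.91]` (`1000 = 2¹⁰/1.024`), `log 1.06 ≤ 0.058272`,
`log 300 ≤ 5.72`, `log L ≤ 3 log 2 − 1 + L/8`, `e^{3.95} ≤ 51.94`.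

## References

* K. Ford, *Vinogradov's integral and bounds for the Riemann zeta function*, Proc. London Math.
  Soc. (3) 85 (2002), 565–633; arXiv:1910.08209: Lemma 3.5 (the recursion), Lemma 3.6 and its proof,
  (3.20)–(3.21). [Ford2002]
-/

noncomputable section

open Real Set

namespace Literature.NumberTheory.LFunctions

namespace FordL36


/-! ### Numerical inputs -/

/-- `log 1000 ∈ [6.9, 6.91]` (`1000 = 1024/1.024`, `log 2` to nine places, `x − x²/2 ≤ log(1+x) ≤ x`). [folklore] -/
theorem log_1000_bounds : (6.9 : ℝ) ≤ Real.log 1000 ∧ Real.log 1000 ≤ 6.91 := by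
  have h2 := Real.log_two_gt_d9
  have h2' := Real.log_two_lt_d9
  have e : Real.log 1000 = 10 * Real.log 2 - Real.log (1 + 0.024) := by
    have : (1000 : ℝ) = 2 ^ 10 / (1 + 0.024) := by norm_num
    rw [this, Real.log_div (by norm_num) (by norm_num), Real.log_pow]; push_cast; ring
  have hu : Real.log (1 + 0.024) ≤ 0.024 := by
    have := Real.log_le_sub_one_of_pos (show (0:ℝ) < 1 + 0.024 by norm_num); linarith
  have hl : 1 - (1 + 0.024)⁻¹ ≤ Real.log (1 + 0.024) := Real.one_sub_inv_le_log_of_pos (by norm_num)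
  norm_num at hl
  rw [e]; constructor <;> nlinarith

/-- `log k ≥ 6.9` for `k ≥ 1000`. [folklore] -/
theorem log_ge_69 {k : ℝ} (hk : 1000 ≤ k) : 6.9 ≤ Real.log k :=
  log_1000_bounds.1.trans (Real.log_le_log (by norm_num) hk)

/-- `log k / k ≤ 0.00691` for `k ≥ 1000` (`log x/x` is decreasing on `[e, ∞)`). [folklore] -/
theorem log_div_le {k : ℝ} (hk : 1000 ≤ k) : Real.log k / k ≤ 0.00691 := by
  have he : Real.exp 1 ≤ 1000 := by have := Real.exp_one_lt_d9; linarith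
  have h := Real.log_div_self_antitoneOn he (he.trans hk) hk
  have h1000 := log_1000_bounds.2
  have : Real.log 1000 / 1000 ≤ 0.00691 := by rw [div_le_iff₀ (by norm_num)]; linarith
  exact h.trans this

/-- `log 1.06 ≤ 0.058272` (`log(1+x) ≤ x − x²/2 + x³/3`). [folklore] -/
theorem log_106_le : Real.log 1.06 ≤ 0.058272 := by
  have h := FordL34.log_one_add_le_cubic (x := 0.06) (by norm_num)
  norm_num at h ⊢
  linarith

/-- `0 < log 1.06`. [folklore] -/
theorem log_106_pos : 0 < Real.log 1.06 := Real.log_pos (by norm_num)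

/-- `log 300 ≤ 5.72` (`e^{5.72} = e⁵ (e^{0.18})⁴ ≥ 148.413 · 1.1962⁴ > 300`). [folklore] -/
theorem log_300_le : Real.log 300 ≤ 5.72 := by
  rw [Real.log_le_iff_le_exp (by norm_num)]
  have he := Real.exp_one_gt_d9
  have h5 : (148.413 : ℝ) ≤ Real.exp 5 := by
    have : Real.exp 5 = Real.exp 1 ^ 5 := by rw [← Real.exp_nat_mul]; norm_num
    rw [this]; nlinarith [pow_le_pow_left₀ (by norm_num : (0:ℝ) ≤ 2.7182818283) he.le 5]
  have h018 : (1.1962 : ℝ) ≤ Real.exp 0.18 := by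
    have := Real.quadratic_le_exp_of_nonneg (show (0:ℝ) ≤ 0.18 by norm_num); linarith
  have h072 : (2.0474 : ℝ) ≤ Real.exp 0.72 := by
    have e : Real.exp 0.72 = Real.exp 0.18 ^ 4 := by rw [← Real.exp_nat_mul]; norm_num
    rw [e]
    nlinarith [pow_le_pow_left₀ (by norm_num : (0:ℝ) ≤ 1.1962) h018 4]
  have e : Real.exp 5.72 = Real.exp 5 * Real.exp 0.72 := by rw [← Real.exp_add]; norm_num
  rw [e]; nlinarith [Real.exp_pos (5 : ℝ), Real.exp_pos (0.72 : ℝ)]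

/-- `log L ≤ 3 log 2 − 1 + L/8` for `L > 0` (tangent of `log` at `8`). [folklore] -/
theorem log_le_tangent_eight {L : ℝ} (hL : 0 < L) : Real.log L ≤ 3 * Real.log 2 - 1 + L / 8 := by
  have h1 : Real.log L = Real.log 8 + Real.log (L / 8) := by
    rw [← Real.log_mul (by norm_num) (by positivity)]; congr 1; ring
  have h2 := Real.log_le_sub_one_of_pos (show 0 < L / 8 by positivity)
  have h8 : Real.log 8 = 3 * Real.log 2 := by
    rw [show (8 : ℝ) = 2 ^ 3 by norm_num, Real.log_pow]; push_cast; ring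
  rw [h1, h8]; linarith

/-- **`V^{k+1} ≤ W = k^{4.12k}`** in logarithmic form: `(k+1) log(300 k³ log k) ≤ 4.12 k log k` for
`k ≥ 1000` (Ford: `(300k³ log k)^{k+1} ≤ k^{4.11k}`, true but razor-thin at `k = 1000`; we give away
`0.01k` in the exponent). [cite: Ford2002, proof of Lemma 3.6 ("V^{k+1} = (300k³ log k)^{k+1} ≤ k^{4.11k} =: W")] -/
theorem succ_mul_log_V_le {k : ℝ} (hk : 1000 ≤ k) :
    (k + 1) * Real.log (300 * k ^ 3 * Real.log k) ≤ 4.12 * k * Real.log k := by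
  have hk0 : 0 < k := by linarith
  set L := Real.log k with hL
  have hL : 6.9 ≤ L := log_ge_69 hk
  have hL0 : 0 < L := by linarith
  have hlog : Real.log (300 * k ^ 3 * L) = Real.log 300 + 3 * L + Real.log L := by
    rw [Real.log_mul (by positivity) hL0.ne', Real.log_mul (by norm_num) (by positivity), Real.log_pow]
    push_cast; ring
  rw [hlog]
  have h300 := log_300_le
  have hLL := log_le_tangent_eight hL0
  have hl2 := Real.log_two_lt_d9
  -- `(k+1)(log 300 + 3L + log L) ≤ (k+1)(6.8 + 3.125 L)`
  have h1 : (k + 1) * (Real.log 300 + 3 * L + Real.log L) ≤ (k + 1) * (6.8 + 3.125 * L) :=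
    mul_le_mul_of_nonneg_left (by linarith) (by linarith)
  -- `(k+1)(6.8 + 3.125L) ≤ 4.12 k L`
  have h2 : (k + 1) * (6.8 + 3.125 * L) ≤ 4.12 * k * L := by
    nlinarith [mul_nonneg (sub_nonneg.2 hk) (sub_nonneg.2 hL)]
  linarith

/-! ### The objects of (3.20): `H_n = k^{3k} η^{4k(n−1)+k²}` (`η = 1.06`) and `V = 300 k³ log k` -/

/-- `H_n = k^{3k}·1.06^{4k(n−1)+k²}`, the first entry of the `max` in the recursion for `C_n`
(Lemma 3.5 with `η = 1 + ω = 1.06`). [cite: Ford2002, Lemma 3.5 and proof of Lemma 3.6] -/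
def Hn (k n : ℕ) : ℝ := (k : ℝ) ^ (3 * k) * (1.06 : ℝ) ^ (4 * k * (n - 1) + k ^ 2)

/-- `V = 300 k³ log k` (`ω = 0.06` in Lemma 3.4: `V = max(e^{1.5+1.5/ω}, (18/ω)k³ log k) = 300k³ log k`
for `k ≥ 1000`). [cite: Ford2002, proof of Lemma 3.6 ("take ω = 0.06")] -/
def Vk (k : ℕ) : ℝ := 300 * (k : ℝ) ^ 3 * Real.log k

/-- Auxiliary step (elementary consequence of the definitions and the standing hypotheses). [folklore] -/
theorem log_Hn {k : ℕ} (hk : 1 ≤ k) (n : ℕ) :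
    Real.log (Hn k n) = 3 * k * Real.log k + (4 * k * (n - 1) + k ^ 2 : ℕ) * Real.log 1.06 := by
  have hk0 : (0 : ℝ) < k := by exact_mod_cast hk
  rw [Hn, Real.log_mul (by positivity) (by positivity), Real.log_pow, Real.log_pow]
  push_cast; ring

/-- Auxiliary step (elementary consequence of the definitions and the standing hypotheses). [folklore] -/
theorem one_le_Hn (k n : ℕ) (hk : 1 ≤ k) : 1 ≤ Hn k n := by
  have hk1 : (1 : ℝ) ≤ k := by exact_mod_cast hk
  unfold Hn
  exact one_le_mul_of_one_le_of_one_le (one_le_pow₀ hk1) (one_le_pow₀ (by norm_num))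

/-- Auxiliary step (elementary consequence of the definitions and the standing hypotheses). [folklore] -/
theorem Vk_pos {k : ℕ} (hk : 1000 ≤ k) : 1 < Vk k := by
  have hkr : (1000 : ℝ) ≤ k := by exact_mod_cast hk
  have hL := log_ge_69 hkr
  unfold Vk
  nlinarith [pow_le_pow_left₀ (by norm_num : (0:ℝ) ≤ 1000) hkr 3]

/-! ### The lower chain `δ_m ≥ 0.0096` for `m ≤ 1.97k + 1` and the decrement `δ_{n−1} − δ_n ≥ 0.019/k` -/

/-- `e^{3.95} ≤ 51.94`. [folklore] -/
theorem exp_395_le : Real.exp 3.95 ≤ 51.94 := by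
  have he := Real.exp_one_lt_d9
  have he0 := Real.exp_pos (1 : ℝ)
  have h4 : Real.exp 4 ≤ 54.5982 := by
    have : Real.exp 4 = Real.exp 1 ^ 4 := by rw [← Real.exp_nat_mul]; norm_num
    rw [this]; nlinarith [pow_le_pow_left₀ he0.le he.le 4]
  have h005 : (1.05125 : ℝ) ≤ Real.exp 0.05 := by
    have := Real.quadratic_le_exp_of_nonneg (show (0:ℝ) ≤ 0.05 by norm_num); linarith
  have e : Real.exp 3.95 = Real.exp 4 / Real.exp 0.05 := by
    rw [← Real.exp_sub]; norm_num
  rw [e, div_le_iff₀ (Real.exp_pos _)]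
  nlinarith

section Constants

variable {k : ℕ} (hk : 1000 ≤ k) {d : ℕ → ℝ} (h1 : d 1 = (1 - 1 / (k : ℝ)) / 2)
  (hanti : ∀ n, 1 ≤ n → d (n + 1) ≤ d n)
  (hrec : ∀ n, 1 ≤ n → 1 / (k : ℝ) < d n → d (n + 1) ≤ F k (d n))
  (hlow : ∀ n, 1 ≤ n → 1 / (k : ℝ) < d n → d n * (1 - 2 / (k : ℝ)) ≤ d (n + 1))

include hk h1 hlow in
/-- **The lower chain**: `δ_m ≥ (1/2)(1−1/k)(1−2/k)^{m−1} ≥ 0.0096` for `1 ≤ m ≤ 1.97k + 1`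
(Ford: `δ̄ = 0.0096476`). [cite: Ford2002, proof of Lemma 3.6 ("δ_{n−1} ≥ (1−2/k)^{n−2}δ₁ ≥ … ≥ 0.0096476")] -/
theorem delta_ge_bar : ∀ m : ℕ, 1 ≤ m → (m : ℝ) ≤ 1.97 * k + 1 → 0.0096 ≤ d m := by
  have hkr : (1000 : ℝ) ≤ k := by exact_mod_cast hk
  have hk0 : (0 : ℝ) < k := by linarith
  have hq0 : 0 < 1 - 2 / (k : ℝ) := by rw [sub_pos, div_lt_one hk0]; linarith
  have hq1 : 1 - 2 / (k : ℝ) ≤ 1 := by have : 0 ≤ 2 / (k : ℝ) := by positivity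
                                       linarith
  -- the geometric minorant is at least `0.0096`
  have hgeo : ∀ m : ℕ, 1 ≤ m → (m : ℝ) ≤ 1.97 * k + 1 →
      0.0096 ≤ (1 - 1 / (k : ℝ)) / 2 * (1 - 2 / (k : ℝ)) ^ (m - 1) := by
    intro m hm hmle
    have hlog : -(2 / ((k : ℝ) - 2)) ≤ Real.log (1 - 2 / (k : ℝ)) := by
      have h := Real.one_sub_inv_le_log_of_pos hq0
      have hk2 : (k : ℝ) - 2 ≠ 0 := by linarith
      have e : 1 - (1 - 2 / (k : ℝ))⁻¹ = -(2 / ((k : ℝ) - 2)) := by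
        rw [show 1 - 2 / (k : ℝ) = ((k : ℝ) - 2) / k by field_simp, inv_div]
        field_simp
        ring
      linarith
    have hm1 : ((m - 1 : ℕ) : ℝ) ≤ 1.97 * k := by
      rw [Nat.cast_sub hm]; push_cast; linarith
    have hpow : Real.exp (-3.95) ≤ (1 - 2 / (k : ℝ)) ^ (m - 1) := by
      rw [← Real.exp_log (pow_pos hq0 _), Real.log_pow, Real.exp_le_exp]
      have h0 : (0 : ℝ) ≤ ((m - 1 : ℕ) : ℝ) := Nat.cast_nonneg _
      have h2 : ((m - 1 : ℕ) : ℝ) * -(2 / ((k : ℝ) - 2)) ≤ ((m - 1 : ℕ) : ℝ) * Real.log (1 - 2 / (k : ℝ)) :=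
        mul_le_mul_of_nonneg_left hlog h0
      have h3 : -3.95 ≤ ((m - 1 : ℕ) : ℝ) * -(2 / ((k : ℝ) - 2)) := by
        have hk2 : (0 : ℝ) < (k : ℝ) - 2 := by linarith
        rw [mul_neg, neg_le_neg_iff, ← mul_div_assoc, div_le_iff₀ hk2]
        nlinarith
      linarith
    have hexp : (51.94 : ℝ)⁻¹ ≤ Real.exp (-3.95) := by
      rw [Real.exp_neg]; exact inv_anti₀ (Real.exp_pos _) exp_395_le
    have hhalf : (0.4995 : ℝ) ≤ (1 - 1 / (k : ℝ)) / 2 := by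
      have : 1 / (k : ℝ) ≤ 1 / 1000 := div_le_div_of_nonneg_left (by norm_num) (by norm_num) hkr
      linarith
    calc (0.0096 : ℝ) ≤ 0.4995 * (51.94 : ℝ)⁻¹ := by norm_num
      _ ≤ (1 - 1 / (k : ℝ)) / 2 * (1 - 2 / (k : ℝ)) ^ (m - 1) :=
          mul_le_mul hhalf (hexp.trans hpow) (by norm_num) (by linarith)
  -- induction
  have hind : ∀ m : ℕ, 1 ≤ m → (m : ℝ) ≤ 1.97 * k + 1 →
      (1 - 1 / (k : ℝ)) / 2 * (1 - 2 / (k : ℝ)) ^ (m - 1) ≤ d m := by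
    intro m hm
    induction m with
    | zero => omega
    | succ m ih =>
      intro hle
      rcases Nat.eq_or_lt_of_le hm with h01 | h01
      · have hm0 : m = 0 := by omega
        subst hm0
        simp [h1]
      · have hm1 : 1 ≤ m := by omega
        have hmle : (m : ℝ) ≤ 1.97 * k + 1 := by push_cast at hle; linarith
        have ihm := ih hm1 hmle
        have hgm := hgeo m hm1 hmle
        have hdm : 1 / (k : ℝ) < d m := by
          have : 1 / (k : ℝ) ≤ 1 / 1000 := div_le_div_of_nonneg_left (by norm_num) (by norm_num) hkr
          linarith
        have hstep := hlow m hm1 hdm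
        have e : (1 - 2 / (k : ℝ)) ^ (m + 1 - 1) = (1 - 2 / (k : ℝ)) ^ (m - 1) * (1 - 2 / (k : ℝ)) := by
          rw [← pow_succ]; congr 1; omega
        rw [e, ← mul_assoc]
        exact (mul_le_mul_of_nonneg_right ihm hq0.le).trans hstep
  intro m hm hle
  exact (hgeo m hm hle).trans (hind m hm hle)

include hk h1 hanti hrec hlow in
/-- **(3.21) quantified**: `δ_{n−1} − δ_n ≥ 0.019/k` for `2 ≤ n ≤ 1.97k + 2` (Ford: `0.01916/k`), from (3.14)
read as a lower bound for the decrement, `(2−δ)/(2−δ²) ≥ 1 − δ/2` and `δ_{n−1} ≥ 0.0096`.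
[cite: Ford2002, proof of Lemma 3.6, (3.21) ("δ_{n−1} − δ_n ≥ 0.01916/k")] -/
theorem decrement_ge {n : ℕ} (hn : 2 ≤ n) (hle : (n : ℝ) ≤ 1.97 * k + 2) :
    0.019 / (k : ℝ) ≤ d (n - 1) - d n := by
  have hkr : (1000 : ℝ) ≤ k := by exact_mod_cast hk
  have hk0 : (0 : ℝ) < k := by linarith
  have hn1 : 1 ≤ n - 1 := by omega
  have hle' : ((n - 1 : ℕ) : ℝ) ≤ 1.97 * k + 1 := by
    rw [Nat.cast_sub (by omega : 1 ≤ n)]; push_cast; linarith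
  set δ := d (n - 1) with hδ
  have hδlo : 0.0096 ≤ δ := delta_ge_bar hk h1 hlow (n - 1) hn1 hle'
  have hδk : 1 / (k : ℝ) < δ := by
    have : 1 / (k : ℝ) ≤ 1 / 1000 := div_le_div_of_nonneg_left (by norm_num) (by norm_num) hkr
    linarith
  have hδhi : δ ≤ 1 / 2 := d_le_half hkr h1 hanti hn1
  have hδ0 : 0 < δ := by linarith
  have hstep : d n ≤ F k δ := by
    have := hrec (n - 1) hn1 hδk
    rwa [show n - 1 + 1 = n by omega] at this
  -- `δ − F(δ) = A(δ)(δβ − c)`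
  have hkey : δ - F k δ = A δ * (δ * β k - c k) := by
    unfold F; field_simp; ring
  have hA : 1 - δ / 2 ≤ A δ := by
    unfold A; rw [le_div_iff₀ (by nlinarith)]; nlinarith
  have hb := beta_pos hkr
  have hβlo : 2 / (k : ℝ) - 32 / (21 * (k : ℝ) ^ 2) = β k := rfl
  have hc : c k = 16 / (7 * (k : ℝ) ^ 3) := rfl
  -- `δβ − c ≥ 0` and `(δ − δ²/2) ≥ 0.00955392`
  have hg : 0.00955392 ≤ δ - δ ^ 2 / 2 := by nlinarith
  have hβ0 : 0 < β k := by
    have : 0 ≤ (k : ℝ) * c k := by rw [hc]; positivity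
    linarith [hb.1]
  have hpos : 0 ≤ δ * β k - c k := by
    rw [← hβlo, hc]
    have e : δ * (2 / (k : ℝ) - 32 / (21 * (k : ℝ) ^ 2)) - 16 / (7 * (k : ℝ) ^ 3) =
        (δ * (42 * (k : ℝ) ^ 2 - 32 * k) - 48) / (21 * (k : ℝ) ^ 3) := by field_simp; ring
    rw [e]; refine div_nonneg ?_ (by positivity); nlinarith
  have hmain : 0.019 / (k : ℝ) ≤ (1 - δ / 2) * (δ * β k - c k) := by
    -- `(1 − δ/2)(δβ − c) ≥ (δ − δ²/2)β − c ≥ 0.00955392 β − c ≥ 0.019/k`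
    have e1 : (1 - δ / 2) * (δ * β k - c k) = (δ - δ ^ 2 / 2) * β k - (1 - δ / 2) * c k := by ring
    rw [e1]
    have hc0 : 0 ≤ c k := by rw [hc]; positivity
    have h2 : (δ - δ ^ 2 / 2) * β k - (1 - δ / 2) * c k ≥ 0.00955392 * β k - c k := by
      nlinarith [mul_le_mul_of_nonneg_right hg hβ0.le]
    have h3 : 0.019 / (k : ℝ) ≤ 0.00955392 * β k - c k := by
      rw [← hβlo, hc, ← sub_nonneg]
      have e : 0.00955392 * (2 / (k : ℝ) - 32 / (21 * (k : ℝ) ^ 2)) - 16 / (7 * (k : ℝ) ^ 3) - 0.019 / k =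
          ((0.00955392 * 42 - 0.019 * 21) * (k : ℝ) ^ 2 - 0.00955392 * 32 * k - 48) / (21 * (k : ℝ) ^ 3) := by
        field_simp; ring
      rw [e]; refine div_nonneg ?_ (by positivity); nlinarith
    linarith
  calc 0.019 / (k : ℝ) ≤ (1 - δ / 2) * (δ * β k - c k) := hmain
    _ ≤ A δ * (δ * β k - c k) := mul_le_mul_of_nonneg_right hA hpos
    _ = δ - F k δ := hkey.symm
    _ ≤ δ - d n := by linarith

include hk h1 hanti hrec hlow in
/-- **(3.20)**: `H_n = k^{3k}1.06^{4k(n−1)+k²} ≤ W^{Δ_{n−1}−Δ_n}`, `W = k^{4.12k}`, `Δ = k²δ`, for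
`2 ≤ n ≤ 1.97k + 1` (in logarithmic form). [cite: Ford2002, (3.20) and its proof] -/
theorem log_Hn_le {n : ℕ} (hn : 2 ≤ n) (hle : (n : ℝ) ≤ 1.97 * k + 1) :
    Real.log (Hn k n) ≤ (k : ℝ) ^ 2 * (d (n - 1) - d n) * (4.12 * k * Real.log k) := by
  have hkr : (1000 : ℝ) ≤ k := by exact_mod_cast hk
  have hk0 : (0 : ℝ) < k := by linarith
  have hL := log_ge_69 hkr
  have hLk := log_div_le hkr
  have hl := log_106_le
  have hl0 := log_106_pos
  have hdec := decrement_ge hk h1 hanti hrec hlow hn (by linarith)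
  rw [log_Hn (by omega) n]
  have hcast : ((4 * k * (n - 1) + k ^ 2 : ℕ) : ℝ) = 4 * k * ((n : ℝ) - 1) + (k : ℝ) ^ 2 := by
    rw [Nat.cast_add, Nat.cast_mul, Nat.cast_mul, Nat.cast_sub (by omega : 1 ≤ n)]; push_cast; ring
  rw [hcast]
  have h888 : 4 * k * ((n : ℝ) - 1) + (k : ℝ) ^ 2 ≤ 8.88 * (k : ℝ) ^ 2 := by nlinarith
  have hlogk : 3 * (k : ℝ) * Real.log k ≤ 0.02073 * (k : ℝ) ^ 2 := by
    rw [div_le_iff₀ hk0] at hLk; nlinarith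
  have hrhs : 0.019 * 4.12 * (k : ℝ) ^ 2 * Real.log k ≤ (k : ℝ) ^ 2 * (d (n - 1) - d n) * (4.12 * k * Real.log k) := by
    have e : (k : ℝ) ^ 2 * (d (n - 1) - d n) * (4.12 * k * Real.log k) =
        ((d (n - 1) - d n) * k) * (4.12 * (k : ℝ) ^ 2 * Real.log k) := by ring
    rw [e]
    have h019 : 0.019 ≤ (d (n - 1) - d n) * k := by rwa [div_le_iff₀ hk0] at hdec
    nlinarith [mul_le_mul_of_nonneg_right h019 (by positivity : (0:ℝ) ≤ 4.12 * (k : ℝ) ^ 2 * Real.log k)]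
  have hmid : (4 * k * ((n : ℝ) - 1) + (k : ℝ) ^ 2) * Real.log 1.06 ≤ 8.88 * (k : ℝ) ^ 2 * 0.058272 := by
    calc (4 * k * ((n : ℝ) - 1) + (k : ℝ) ^ 2) * Real.log 1.06 ≤ 8.88 * (k : ℝ) ^ 2 * Real.log 1.06 :=
          mul_le_mul_of_nonneg_right h888 hl0.le
      _ ≤ 8.88 * (k : ℝ) ^ 2 * 0.058272 := mul_le_mul_of_nonneg_left hl (by positivity)
  nlinarith [mul_le_mul_of_nonneg_left hL (by positivity : (0:ℝ) ≤ (k : ℝ) ^ 2)]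

variable {C : ℕ → ℝ} (hCpos : ∀ n, 1 ≤ n → 0 < C n) (hC1 : C 1 = (Nat.factorial k : ℝ))
  (hC : ∀ n, 2 ≤ n → C n ≤ C (n - 1) *
    max (Hn k n) (Vk k ^ (((k : ℝ) + 1) * ((k : ℝ) ^ 2 * d (n - 1) - (k : ℝ) ^ 2 * d n))))

include hk hanti hCpos hC in
/-- One step of the `C`-recursion in logarithmic form: `log C_n ≤ log C_{n−1} + max(log H_n, (Δ_{n−1}−Δ_n)·4.12 k log k)`
(`V^{k+1} ≤ k^{4.12k}`). [cite: Ford2002, Lemma 3.5 (the recursion for `C_n`) and proof of Lemma 3.6] -/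
theorem log_C_step {n : ℕ} (hn : 2 ≤ n) :
    Real.log (C n) ≤ Real.log (C (n - 1)) +
      max (Real.log (Hn k n)) ((k : ℝ) ^ 2 * (d (n - 1) - d n) * (4.12 * k * Real.log k)) := by
  have hkr : (1000 : ℝ) ≤ k := by exact_mod_cast hk
  have hk0 : (0 : ℝ) < k := by linarith
  have hV := Vk_pos hk
  have hH := one_le_Hn k n (by omega)
  have hD : 0 ≤ (k : ℝ) ^ 2 * d (n - 1) - (k : ℝ) ^ 2 * d n := by
    have := hanti (n - 1) (by omega)
    rw [show n - 1 + 1 = n by omega] at this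
    nlinarith
  have hCn := hC n hn
  have hC0 := hCpos (n - 1) (by omega)
  set M := max (Hn k n) (Vk k ^ (((k : ℝ) + 1) * ((k : ℝ) ^ 2 * d (n - 1) - (k : ℝ) ^ 2 * d n))) with hM
  have hM1 : 1 ≤ M := le_trans hH (le_max_left _ _)
  have hlog : Real.log (C n) ≤ Real.log (C (n - 1)) + Real.log M := by
    rw [← Real.log_mul hC0.ne' (by linarith)]
    exact Real.log_le_log (hCpos n (by omega)) hCn
  suffices hsuf : Real.log M ≤
      max (Real.log (Hn k n)) ((k : ℝ) ^ 2 * (d (n - 1) - d n) * (4.12 * k * Real.log k)) by linarith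
  -- `log M ≤ max (log H) (D · 4.12 k log k)`
  rcases max_cases (Hn k n) (Vk k ^ (((k : ℝ) + 1) * ((k : ℝ) ^ 2 * d (n - 1) - (k : ℝ) ^ 2 * d n))) with ⟨h, _⟩ | ⟨h, _⟩
  · rw [hM, h]; exact le_max_left _ _
  · rw [hM, h, Real.log_rpow (by linarith)]
    refine le_trans ?_ (le_max_right _ _)
    have hW := succ_mul_log_V_le hkr
    unfold Vk
    calc ((k : ℝ) + 1) * ((k : ℝ) ^ 2 * d (n - 1) - (k : ℝ) ^ 2 * d n) * Real.log (300 * (k : ℝ) ^ 3 * Real.log k)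
        = ((k : ℝ) ^ 2 * (d (n - 1) - d n)) * (((k : ℝ) + 1) * Real.log (300 * (k : ℝ) ^ 3 * Real.log k)) := by ring
      _ ≤ ((k : ℝ) ^ 2 * (d (n - 1) - d n)) * (4.12 * k * Real.log k) :=
          mul_le_mul_of_nonneg_left hW (by nlinarith)
      _ = _ := by ring

include hk h1 hanti hrec hlow hCpos hC in
/-- **Phase 1** (`n ≤ 1.97k + 1`): `log C_n ≤ log C_1 + (Δ_1 − Δ_n)·4.12 k log k`.
[cite: Ford2002, proof of Lemma 3.6 ("C_{n₀} ≤ W^{Δ₁ − Δ_{n₀}} k!")] -/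
theorem log_C_phase1 : ∀ n : ℕ, 1 ≤ n → (n : ℝ) ≤ 1.97 * k + 1 →
    Real.log (C n) ≤ Real.log (C 1) + (k : ℝ) ^ 2 * (d 1 - d n) * (4.12 * k * Real.log k) := by
  intro n hn
  induction n with
  | zero => omega
  | succ n ih =>
    intro hle
    rcases Nat.eq_or_lt_of_le hn with h01 | h01
    · have : n = 0 := by omega
      subst this; simp
    · have hn1 : 1 ≤ n := by omega
      have hIH := ih hn1 (by push_cast at hle; linarith)
      have hstep := log_C_step hk hanti hCpos hC (n := n + 1) (by omega)
      have h320 := log_Hn_le hk h1 hanti hrec hlow (n := n + 1) (by omega) hle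
      rw [Nat.add_one_sub_one] at hstep h320
      have hmax : max (Real.log (Hn k (n + 1))) ((k : ℝ) ^ 2 * (d n - d (n + 1)) * (4.12 * k * Real.log k))
          = (k : ℝ) ^ 2 * (d n - d (n + 1)) * (4.12 * k * Real.log k) := max_eq_right h320
      rw [hmax] at hstep
      nlinarith

include hk hanti hCpos hC in
/-- **Phase 2** (`n ≥ N₀`): `log C_n ≤ log C_{N₀} + (Δ_{N₀} − Δ_n)·4.12k log k + ∑_{N₀ < m ≤ n} log H_m`, the sum in
closed form. [cite: Ford2002, proof of Lemma 3.6 ("Iterating this last inequality gives, for n > n₀, …")] -/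
theorem log_C_phase2 {N₀ : ℕ} (hN : 2 ≤ N₀) : ∀ n : ℕ, N₀ ≤ n →
    Real.log (C n) ≤ Real.log (C N₀) + (k : ℝ) ^ 2 * (d N₀ - d n) * (4.12 * k * Real.log k) +
      (((n : ℝ) - N₀) * (3 * k * Real.log k + (k : ℝ) ^ 2 * Real.log 1.06) +
        2 * k * Real.log 1.06 * ((n : ℝ) * (n - 1) - (N₀ : ℝ) * (N₀ - 1))) := by
  have hkr : (1000 : ℝ) ≤ k := by exact_mod_cast hk
  refine Nat.le_induction (by simp) fun n hNn ih ↦ ?_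
  have hstep := log_C_step hk hanti hCpos hC (n := n + 1) (by omega)
  rw [Nat.add_one_sub_one] at hstep
  have hH := one_le_Hn k (n + 1) (by omega)
  have hlogH : 0 ≤ Real.log (Hn k (n + 1)) := Real.log_nonneg hH
  have hD : 0 ≤ (k : ℝ) ^ 2 * (d n - d (n + 1)) * (4.12 * k * Real.log k) := by
    have := hanti n (by omega)
    have hL := log_ge_69 hkr
    have : 0 ≤ d n - d (n + 1) := by linarith
    positivity
  have hmax : max (Real.log (Hn k (n + 1))) ((k : ℝ) ^ 2 * (d n - d (n + 1)) * (4.12 * k * Real.log k))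
      ≤ Real.log (Hn k (n + 1)) + (k : ℝ) ^ 2 * (d n - d (n + 1)) * (4.12 * k * Real.log k) :=
    max_le (by linarith) (by linarith)
  rw [log_Hn (by omega) (n + 1)] at hmax hstep
  have hcast : ((4 * k * (n + 1 - 1) + k ^ 2 : ℕ) : ℝ) = 4 * k * (n : ℝ) + (k : ℝ) ^ 2 := by
    rw [Nat.add_one_sub_one]; push_cast; ring
  rw [hcast] at hmax hstep
  push_cast
  nlinarith

set_option maxHeartbeats 400000 in
include hk h1 hanti hrec hlow hCpos hC in
/-- **Ford's Lemma 3.6, the constants (definition-free form)**: for `k ≥ 1000`, a non-increasing,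
non-negative sequence `(δ_n)` with `δ₁ = (1−1/k)/2` satisfying (3.14) from above and
`δ_{n+1} ≥ δ_n(1 − 2/k)` from below whenever `δ_n > 1/k`, and positive `C_n` with `C₁ = k!`,
`C_n ≤ C_{n−1} max[k^{3k}1.06^{4k(n−1)+k²}, V^{(k+1)(Δ_{n−1}−Δ_n)}]` (`Δ_n = k²δ_n`, `V = 300k³ log k`),
one has for every `n ≥ 2k`:
`C_n ≤ k^{2.06k³ − 5.91k² + 3nk} · 1.06^{nk² + 2(n²−n)k − 9.7278k³}`
(Ford: `2.055k³`, from `W = k^{4.11k}`; here `W = k^{4.12k}`, see `succ_mul_log_V_le`).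
[cite: Ford2002, Lemma 3.6 (the bound for `C_n`) and its proof, (3.20)–(3.21)] -/
theorem C_le_closed_form (hdpos : ∀ n, 1 ≤ n → 0 ≤ d n) (hC1 : C 1 = (Nat.factorial k : ℝ))
    {n : ℕ} (hn : 2 * k ≤ n) :
    C n ≤ (k : ℝ) ^ ((2.06 : ℝ) * (k : ℝ) ^ 3 - 5.91 * (k : ℝ) ^ 2 + 3 * n * k) *
      (1.06 : ℝ) ^ ((n : ℝ) * (k : ℝ) ^ 2 + 2 * ((n : ℝ) ^ 2 - n) * k - 9.7278 * (k : ℝ) ^ 3) := by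
  have hkr : (1000 : ℝ) ≤ k := by exact_mod_cast hk
  have hk0 : (0 : ℝ) < k := by linarith
  set L := Real.log k with hLdef
  set l := Real.log 1.06 with hldef
  have hL := log_ge_69 hkr
  have hl0 := log_106_pos
  -- `N₀ = ⌊1.97k⌋ + 1`
  set N₀ : ℕ := ⌊(1.97 : ℝ) * k⌋₊ + 1 with hN₀
  have hN₀gt : 1.97 * (k : ℝ) < N₀ := by rw [hN₀]; push_cast; exact Nat.lt_floor_add_one _
  have hN₀le : (N₀ : ℝ) ≤ 1.97 * k + 1 := by
    rw [hN₀]; push_cast; linarith [Nat.floor_le (show (0:ℝ) ≤ 1.97 * k by positivity)]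
  have hN₀2 : 2 ≤ N₀ := by
    have : (2 : ℝ) ≤ N₀ := by linarith
    exact_mod_cast this
  have hnr : (2 : ℝ) * k ≤ n := by exact_mod_cast hn
  have hN₀n : N₀ ≤ n := by
    have : (N₀ : ℝ) ≤ n := by linarith
    exact_mod_cast this
  have p1 := log_C_phase1 hk h1 hanti hrec hlow hCpos hC N₀ (by omega) hN₀le
  have p2 := log_C_phase2 hk hanti hCpos hC hN₀2 n hN₀n
  rw [← hLdef] at p1
  rw [← hLdef, ← hldef] at p2
  have esum : (k : ℝ) ^ 2 * (d 1 - d N₀) * (4.12 * k * L) + (k : ℝ) ^ 2 * (d N₀ - d n) * (4.12 * k * L)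
      = (k : ℝ) ^ 2 * (d 1 - d n) * (4.12 * k * L) := by ring
  -- ingredients
  have hfact : Real.log (C 1) ≤ k * L := by
    rw [hC1]
    have h1' : (Nat.factorial k : ℝ) ≤ (k : ℝ) ^ k := by exact_mod_cast Nat.factorial_le_pow k
    have h0 : (0 : ℝ) < Nat.factorial k := by exact_mod_cast Nat.factorial_pos k
    calc Real.log (Nat.factorial k : ℝ) ≤ Real.log ((k : ℝ) ^ k) := Real.log_le_log h0 h1'
      _ = k * L := by rw [Real.log_pow]
  have hd1n : d 1 - d n ≤ (1 - 1 / (k : ℝ)) / 2 := by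
    have := hdpos n (by omega); rw [h1]; linarith
  have hNN : 1.97 * (k : ℝ) * (1.97 * k - 1) ≤ (N₀ : ℝ) * (N₀ - 1) := by nlinarith
  have hLpos : 0 < 4.12 * (k : ℝ) * L := by positivity
  -- the total in logarithmic form
  have htot : Real.log (C n) ≤ ((2.06 : ℝ) * (k : ℝ) ^ 3 - 5.91 * (k : ℝ) ^ 2 + 3 * n * k) * L +
      ((n : ℝ) * (k : ℝ) ^ 2 + 2 * ((n : ℝ) ^ 2 - n) * k - 9.7278 * (k : ℝ) ^ 3) * l := by
    have e1 : (k : ℝ) ^ 2 * (d 1 - d n) * (4.12 * k * L) ≤ (k : ℝ) ^ 2 * ((1 - 1 / (k : ℝ)) / 2) * (4.12 * k * L) := by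
      have := mul_le_mul_of_nonneg_left hd1n (by positivity : (0:ℝ) ≤ (k : ℝ) ^ 2)
      exact mul_le_mul_of_nonneg_right this hLpos.le
    have e2 : ((n : ℝ) - N₀) * (3 * k * L + (k : ℝ) ^ 2 * l) ≤ ((n : ℝ) - 1.97 * k) * (3 * k * L + (k : ℝ) ^ 2 * l) :=
      mul_le_mul_of_nonneg_right (by linarith) (by positivity)
    have e3 : 2 * k * l * ((n : ℝ) * (n - 1) - (N₀ : ℝ) * (N₀ - 1)) ≤
        2 * k * l * ((n : ℝ) * (n - 1) - 1.97 * k * (1.97 * k - 1)) :=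
      mul_le_mul_of_nonneg_left (by linarith) (by positivity)
    have e4 : (k : ℝ) ^ 2 * ((1 - 1 / (k : ℝ)) / 2) * (4.12 * k * L) = (2.06 * (k : ℝ) ^ 3 - 2.06 * (k : ℝ) ^ 2) * L := by
      have hk' : (k : ℝ) ≠ 0 := hk0.ne'
      have hkk : (k : ℝ) ^ 2 * (1 - 1 / (k : ℝ)) = (k : ℝ) ^ 2 - k := by field_simp
      calc (k : ℝ) ^ 2 * ((1 - 1 / (k : ℝ)) / 2) * (4.12 * k * L)
          = ((k : ℝ) ^ 2 * (1 - 1 / (k : ℝ))) / 2 * (4.12 * k * L) := by ring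
        _ = ((k : ℝ) ^ 2 - k) / 2 * (4.12 * k * L) := by rw [hkk]
        _ = _ := by ring
    -- compare the polynomial coefficients
    have c1 : (k : ℝ) + (2.06 * (k : ℝ) ^ 3 - 2.06 * (k : ℝ) ^ 2) + ((n : ℝ) - 1.97 * k) * (3 * k) ≤
        (2.06 : ℝ) * (k : ℝ) ^ 3 - 5.91 * (k : ℝ) ^ 2 + 3 * n * k := by
      nlinarith [mul_nonneg hk0.le (by linarith : (0:ℝ) ≤ (k : ℝ) - 1)]
    have c2 : ((n : ℝ) - 1.97 * k) * (k : ℝ) ^ 2 + 2 * k * ((n : ℝ) * (n - 1) - 1.97 * k * (1.97 * k - 1)) ≤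
        (n : ℝ) * (k : ℝ) ^ 2 + 2 * ((n : ℝ) ^ 2 - n) * k - 9.7278 * (k : ℝ) ^ 3 := by
      nlinarith [mul_nonneg (sq_nonneg (k : ℝ)) (by linarith : (0:ℝ) ≤ (k : ℝ) - 985)]
    have hLge : 0 ≤ L := by linarith
    have hlge : 0 ≤ l := hl0.le
    have f1 := mul_le_mul_of_nonneg_right c1 hLge
    have f2 := mul_le_mul_of_nonneg_right c2 hlge
    have expand1 : ((k : ℝ) + (2.06 * (k : ℝ) ^ 3 - 2.06 * (k : ℝ) ^ 2) + ((n : ℝ) - 1.97 * k) * (3 * k)) * L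
        = k * L + (2.06 * (k : ℝ) ^ 3 - 2.06 * (k : ℝ) ^ 2) * L + ((n : ℝ) - 1.97 * k) * (3 * k * L) := by ring
    have expand2 : (((n : ℝ) - 1.97 * k) * (k : ℝ) ^ 2 + 2 * k * ((n : ℝ) * (n - 1) - 1.97 * k * (1.97 * k - 1))) * l
        = ((n : ℝ) - 1.97 * k) * ((k : ℝ) ^ 2 * l) + 2 * k * l * ((n : ℝ) * (n - 1) - 1.97 * k * (1.97 * k - 1)) := by ring
    have expand3 : ((n : ℝ) - 1.97 * k) * (3 * k * L + (k : ℝ) ^ 2 * l)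
        = ((n : ℝ) - 1.97 * k) * (3 * k * L) + ((n : ℝ) - 1.97 * k) * ((k : ℝ) ^ 2 * l) := by ring
    linarith
  -- exponentiate
  have hCn := hCpos n (by omega)
  rw [← Real.exp_log hCn, Real.rpow_def_of_pos hk0, Real.rpow_def_of_pos (by norm_num), ← Real.exp_add]
  exact Real.exp_le_exp.2 (by rw [← hLdef, ← hldef]; linarith)

end Constants

end FordL36
end Literature.NumberTheory.LFunctions
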